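import Literature.NumberTheory.EllipticCurves.HeegnerPointsKolyvaginPrimaryClassesProofs
import Literature.NumberTheory.EllipticCurves.LocalKummerMap
import HarnessLib

/-!
# X11b at `p = 3` (team N8/O2), JET3-KUMMER input (c): the point `U` of Jetchev's cocycle —
# from `res_v c(P) = δ_v(t)` to `nU = P_v − t`, `(σ−1)U = ((σ−1)P/n)_v` in `E(K̄_v)`

HONEST FRAMING (cell `b2b-bsdres`, run/shared/lean/b2b/bsd-rank1-residual/, verbatim in every
file): the goal of the cell is to DELETE the COMBINATION-SHAPED residual classes of the
Birch–Swinnerton-Dyer formula for ALL analytic-rank `≤ 1` elliptic curves over `ℚ` — "full BSD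
formula for every rank `≤ 1` curve in class `C`" assembled STRICTLY from published theorems — so
that the rank-`≤ 1` remainder becomes exactly the CONSTRUCTION-SHAPED classes, which are TYPED
(missing-input `Prop`s), NOT attempted. This is not "finishing BSD". Team N8/O2 = `x11b3`, seat
`b2b-bsdres-x11b3-p1`, JET3-KUMMER chain (HOME/b2b-bsdres-x11b3-p1/JET3-KUMMER-CHAIN.md), named
input "(c) the cocycle": THEOREMS ONLY; no definition, no named fact, no `sorry`; nothing booked;
the flag `JET@p|N` is NOT discharged here.

## What

Harvest-2 E66 (C)(ii), step (c) (= Jetchev 2008, proof of Prop. 4.1, display (4) / McCallum 1991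
Lemma 4.1): "From `δ_v(T) = loc_v κ`: there is `e ∈ E[p^m]` with
`−R_σ + (σ̃−1)(W − V_T − e) = 0` for all `σ̃ ∈ G_{K_v}` (`V_T` a `p^m`-th root of `T`), i.e.
`U := W − V_T − e` satisfies `(σ̃−1)U = R_σ`; … `p^m U = P_c − T`." On the tree's objects: for
Kolyvagin's class `c(P) = kolyvaginClass W n hdiv hA P hP ∈ H¹(K, E[n])` (McCallum's cocycle
`g ↦ gQ₀ − Q₀ − (g−1)P/n`, `nQ₀ = P`) and a `K`-field `E` (a completion `K_v`), IF
`res_E c(P) = δ_E(t)` for an `E`-rational point `t` (`W.localKummerMap E hn t`; this is the Selmer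
local condition at `E`, `Three/KolyvaginClassBadPlace.lean` §3), THEN the two cocycles differ by
the coboundary of an `n`-torsion point, and `U := Q₀ − V_t − e ∈ E(K̄_E)` satisfies
**`n • U = P_E − t`** and **`σ • U − U = ((resGal σ − 1)P/n)_E`** for every `σ ∈ Γ_E`
(`exists_localPoints_root_of_res_kolyvaginClass_eq`); in particular `U` is fixed by every `σ`
with `resGal σ • P = P` (`Γ_{K_{n,w}}`), i.e. "`U ∈ E(K[c]_w)`" (`smul_eq_of_smul_eq`).

This is the algebraic content of the cocycle input of `Three/JetchevKummerAtP.lean` (`hU`, `hpU`)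
and `Three/JetchevKummerLink(Global).lean` §3/§5, in the restricted-global currency of the Selmer
group; the remaining hand-over to Mathlib's `L`-points `((W⁄F)⁄L)(L)` for the finite unramified
`L = K[c]_w ⊂ K̄_v` (Galois descent for an intermediate field of `K̄_v/K_v`) is plumbing not done
here. References (locators only; no cited FACT): [cite: Jetchev2008, Prop. 4.1 proof, display (4)
(pp. 819–821)] [cite: McCallumLMS1991, Lemma 4.1, Cor. 4.2] [cite: GrossLMS1991, §4 (4.6)]
[cite: SilvermanAEC2009, VIII.§2, X.§4 diagram (**)].
-/

noncomputable section

open scoped Classical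
open scoped AddSubgroup

namespace Summit.BirchSwinnertonDyer.Rank1Residual.X11b.Three.GrossBadPlace

open WeierstrassCurve Field
  Literature.NumberTheory.EllipticCurves Literature.NumberTheory.EllipticCurves.KolyvaginCocycle
  Literature.NumberTheory.GaloisRepresentations

universe u

variable {K : Type u} [Field K] [CharZero K] (W : WeierstrassCurve K) [W.IsElliptic] {n : ℤ}
  (hn : n ≠ 0) {hdiv : ∀ P : geomPoints W, ∃ Q : geomPoints W, n • Q = P}
  {A : AddSubgroup (geomPoints W)}
  (E : Type u) [Field E] [Algebra K E]

/-- **The point `U` of Jetchev's cocycle from the Selmer condition** (Jetchev 2008, proof of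
Prop. 4.1, (4); McCallum 1991, Lemma 4.1 / Cor. 4.2; harvest E66 (C)(ii) step (c)). If the
restriction to `Γ_E` of Kolyvagin's class `c(P)` (McCallum's cocycle with the root `Q₀`,
`n Q₀ = P`) equals the local Kummer class `δ_E(t)` of an `E`-rational point `t`, then there is
`U ∈ E(K̄_E)` with `n • U = P_E − t_E` and `σ • U − U = ((resGal σ − 1)P/n)_E` for all `σ ∈ Γ_E`
(`P_E = pointsMap W E P`, `t_E` = `t` read in `E(K̄_E)`): the two cocycles
`σ ↦ σQ₀ − Q₀ − (σ−1)P/n` and `σ ↦ σV − V` (`nV = t`) differ by the coboundary of an `n`-torsion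
point `e`, and `U = Q₀ − V − e`. [cite: Jetchev2008, Prop. 4.1 proof (4)]
[cite: McCallumLMS1991, Lemma 4.1, Cor. 4.2] -/
theorem exists_localPoints_root_of_res_cls_eq (hA : IsAdmissible (absoluteGaloisGroup K) A n)
    {P : geomPoints W} (hP : P ∈ invPoints (absoluteGaloisGroup K) A n) {Q₀ : geomPoints W}
    (hQ₀ : n • Q₀ = P) (t : (W.baseChange E).toAffine.Point)
    (h : galoisCohomology.res (W.torsionGaloisModule n) E 1
        (cls hA (continuous_smul_geomPoints W) hP hQ₀) = W.localKummerMap E hn t) :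
    ∃ U : localPoints W E,
      n • U = pointsMap W E P - W.baseChangeGeomPointsEquiv E (toGeomPoints (W.baseChange E) t) ∧
      ∀ σ : absoluteGaloisGroup E,
        σ • U - U = pointsMap W E (rootIn A n (resGal (K := K) E σ • P - P)) := by
  -- the chosen root `V` of `t` and the two cocycles
  set V : localPoints W E := W.localZSMulRoot E hn t with hVdef
  have hV : n • V ∈ MulAction.fixedPoints (absoluteGaloisGroup E) (localPoints W E) :=
    W.zsmul_mem_fixedPoints_of_eq E (W.zsmul_localZSMulRoot E hn t)
  have h' : oneCocycleClass
      (DiscreteGaloisModule.toTopRep (GaloisRep.restrictField E (W.torsionGaloisModule n)))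
      (contOneCocycles.pullback (absGaloisRestrict K E)
        (X := discreteTopRep (absoluteGaloisGroup K) (geomTorsion W n))
        (Y := DiscreteGaloisModule.toTopRep (GaloisRep.restrictField E (W.torsionGaloisModule n)))
        (TopRep.ofHom ⟨ContinuousLinearMap.id ℤ (geomTorsion W n), fun _ => rfl⟩)
        (cocycle hA (continuous_smul_geomPoints W) hP hQ₀)) =
      W.localKummerClass n hn V hV := by
    rw [← res_torsionGaloisModule_oneCocycleClass]
    exact h
  unfold localKummerClass at h'
  rw [← sub_eq_zero, ← oneCocycleClass_sub, oneCocycleClass_eq_zero_iff] at h'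
  obtain ⟨e, he⟩ := h'
  -- read the coboundary identity in `E(K̄_E)`
  have key : ∀ σ : absoluteGaloisGroup E,
      σ • pointsMap W E Q₀ - pointsMap W E Q₀ -
          pointsMap W E (rootIn A n (resGal (K := K) E σ • P - P)) - (σ • V - V) =
        σ • pointsMap W E (e : geomPoints W) - pointsMap W E (e : geomPoints W) := by
    intro σ
    have h1 := congrArg (fun x : geomTorsion W n ↦ pointsMap W E (x : geomPoints W)) (he σ)
    simp only at h1
    have h2 : pointsMap W E (((contOneCocycles.pullback (absGaloisRestrict K E)
        (X := discreteTopRep (absoluteGaloisGroup K) (geomTorsion W n))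
        (Y := DiscreteGaloisModule.toTopRep (GaloisRep.restrictField E (W.torsionGaloisModule n)))
        (TopRep.ofHom ⟨ContinuousLinearMap.id ℤ (geomTorsion W n), fun _ => rfl⟩)
        (cocycle hA (continuous_smul_geomPoints W) hP hQ₀) -
          W.localKummerCocycle n hn V hV).1 σ : geomTorsion W n) : geomPoints W) =
        σ • pointsMap W E Q₀ - pointsMap W E Q₀ -
          pointsMap W E (rootIn A n (resGal (K := K) E σ • P - P)) - (σ • V - V) := by
      rw [← W.pointsMap_localKummerCocycle_apply n hn V hV σ]
      change pointsMap W E (((cocycle hA (continuous_smul_geomPoints W) hP hQ₀).1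
          (absGaloisRestrict K E σ) : geomPoints W) -
            ((W.localKummerCocycle n hn V hV).1 σ : geomPoints W)) = _
      rw [map_sub, coe_cocycle_apply, map_sub, map_sub, ← resGal_eq_absGaloisRestrict,
        pointsMap_smul]
    have h3 : pointsMap W E ((((DiscreteGaloisModule.toTopRep
        (GaloisRep.restrictField E (W.torsionGaloisModule n))).ρ σ e - e :
          geomTorsion W n) : geomPoints W)) =
        σ • pointsMap W E (e : geomPoints W) - pointsMap W E (e : geomPoints W) := by
      change pointsMap W E ((((absGaloisRestrict K E σ • e : geomTorsion W n)) : geomPoints W) -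
        (e : geomPoints W)) = _
      rw [map_sub, Literature.NumberTheory.EllipticCurves.AddSubgroup.torsionBy.coe_smul,
        ← resGal_eq_absGaloisRestrict, pointsMap_smul]
    rw [← h2, ← h3]
    exact h1
  refine ⟨pointsMap W E Q₀ - V - pointsMap W E (e : geomPoints W), ?_, fun σ ↦ ?_⟩
  · have he0 : n • pointsMap W E (e : geomPoints W) = 0 := by
      rw [← map_zsmul, (mem_geomTorsion_iff W n _).mp e.2, map_zero]
    rw [zsmul_sub, zsmul_sub, ← map_zsmul, hQ₀, hVdef, W.zsmul_localZSMulRoot E hn t, he0, sub_zero]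
  · have := key σ
    rw [smul_sub, smul_sub]
    -- rearrange `key`
    have e1 : σ • pointsMap W E Q₀ - σ • V - σ • pointsMap W E (e : geomPoints W) -
        (pointsMap W E Q₀ - V - pointsMap W E (e : geomPoints W)) =
        (σ • pointsMap W E Q₀ - pointsMap W E Q₀ -
          pointsMap W E (rootIn A n (resGal (K := K) E σ • P - P)) - (σ • V - V)) -
          (σ • pointsMap W E (e : geomPoints W) - pointsMap W E (e : geomPoints W)) +
          pointsMap W E (rootIn A n (resGal (K := K) E σ • P - P)) := by abel
    rw [e1, this, sub_self, zero_add]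

/-- The same for the tree's `kolyvaginClass` (any choice of the root is allowed, the class being
independent of it): **`res_E c(P) = δ_E(t)` ⇒ `∃ U ∈ E(K̄_E)`, `n • U = P_E − t_E`,
`σ • U − U = ((resGal σ − 1)P/n)_E`.** [cite: Jetchev2008, Prop. 4.1 proof (4)]
[cite: McCallumLMS1991, Lemma 4.1] -/
theorem exists_localPoints_root_of_res_kolyvaginClass_eq
    (hA : IsAdmissible (absoluteGaloisGroup K) A n)
    {P : geomPoints W} (hP : P ∈ invPoints (absoluteGaloisGroup K) A n)
    (t : (W.baseChange E).toAffine.Point)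
    (h : galoisCohomology.res (W.torsionGaloisModule n) E 1 (kolyvaginClass W n hdiv hA P hP) =
      W.localKummerMap E hn t) :
    ∃ U : localPoints W E,
      n • U = pointsMap W E P - W.baseChangeGeomPointsEquiv E (toGeomPoints (W.baseChange E) t) ∧
      ∀ σ : absoluteGaloisGroup E,
        σ • U - U = pointsMap W E (rootIn A n (resGal (K := K) E σ • P - P)) :=
  exists_localPoints_root_of_res_cls_eq W hn E hA hP (Classical.choose_spec (hdiv P)) t h

omit [CharZero K] [W.IsElliptic] in
/-- **`U` is fixed by the stabiliser of `P`** ("`U ∈ E(K[c]_w)`": for `σ̃ ∈ G_{K[c]_w}` the root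
`(σ̃−1)P/n` is `0`). [cite: Jetchev2008, Prop. 4.1 proof] -/
theorem smul_eq_of_smul_eq (hA : IsAdmissible (absoluteGaloisGroup K) A n) {P : geomPoints W}
    {U : localPoints W E}
    (hU : ∀ σ : absoluteGaloisGroup E,
      σ • U - U = pointsMap W E (rootIn A n (resGal (K := K) E σ • P - P)))
    {σ : absoluteGaloisGroup E} (hσ : resGal (K := K) E σ • P = P) : σ • U = U := by
  have h := hU σ
  rw [hσ, sub_self, rootIn_zero hA.eq_zero_of_zsmul, map_zero, sub_eq_zero] at h
  exact h

/-- **From the Selmer condition directly**: if `c(P) ∈ selmerLocalKer W E n` then such a point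
`t ∈ (W⁄E)(E)` and such a `U ∈ E(K̄_E)` exist (`Three/KolyvaginClassBadPlace.lean` §3 gives `t`).
[cite: McCallumLMS1991, Lemma 4.3, Lemma 4.1] -/
theorem exists_localPoints_root_of_mem_selmerLocalKer [CharZero E] (hn : n ≠ 0)
    (hA : IsAdmissible (absoluteGaloisGroup K) A n)
    {P : geomPoints W} (hP : P ∈ invPoints (absoluteGaloisGroup K) A n)
    (hc : kolyvaginClass W n hdiv hA P hP ∈ selmerLocalKer W E n) :
    ∃ (t : (W.baseChange E).toAffine.Point) (U : localPoints W E),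
      n • U = pointsMap W E P - W.baseChangeGeomPointsEquiv E (toGeomPoints (W.baseChange E) t) ∧
      ∀ σ : absoluteGaloisGroup E,
        σ • U - U = pointsMap W E (rootIn A n (resGal (K := K) E σ • P - P)) := by
  have hc' : galoisCohomology.res (W.torsionGaloisModule n) E 1 (kolyvaginClass W n hdiv hA P hP) ∈
      W.kummerLocalConditionAt n E := by
    rw [← comap_res_kummerLocalConditionAt] at hc
    exact hc
  rw [← W.range_localKummerMap E hn] at hc'
  obtain ⟨t, ht⟩ := hc'
  exact ⟨t, exists_localPoints_root_of_res_kolyvaginClass_eq W hn E hA hP t ht.symm⟩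

end Summit.BirchSwinnertonDyer.Rank1Residual.X11b.Three.GrossBadPlace

end
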